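import Summits.BirchSwinnertonDyer.BirchSwinnertonDyer.Theorems.KimAtThreeKolyvaginDeepUpperRung
import HarnessLib

/-!
# Route `KimAtThreeKolyvagin` (rung W2): the three cruxes on the UNIT-`δ̃₁` slice — calibration rungs

On the rows where the level-`1` Kurihara number `δ̃₁ = [0]⁺_f = L(E,1)/Ω⁺_f` is a `3`-adic UNIT
(`ord₃ [0]⁺_f = 0`), every invariant of the route's three cruxes is computed outright from the
definitions of `KuriharaNumberInvariants` / `KuriharaNumberDeepInvariants`:
`∂⁽⁰⁾(δ̃) = ∂^{(∞)}(δ̃) = ∂^{(∞)}_{deep}(δ̃) = 0` (the level `n = 1` lies in every `𝒩_k`, so a unit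
there kills the shallow AND the deep infimum). Hence, on that slice:
* `DeepLowerAtThree` (item 19075: `∂⁽⁰⁾ ≤ ord₃ #Ш(3) + ∂^{(∞)}_{deep}`) holds UNCONDITIONALLY
  (`deepLowerAtThree_of_unitLevelOne`);
* `ShallowEqDeepAtTorsionFree` (item 19077: `∂^{(∞)}_{deep} ≤ ∂^{(∞)}`) holds UNCONDITIONALLY
  (`shallowEqDeepAtTorsionFree_of_unitLevelOne`);
* `DeepUpperAtThree` (item 19076: `ord₃ #Ш(3) + ∂^{(∞)}_{deep} ≤ ∂⁽⁰⁾`) reads `Ш(E/ℚ)[3^∞] = 0`, which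
  on Kato's printed stratum (additive potentially good `3`, tower ⇒ (12.5.2), period transfer) IS
  the named published fact `Kato2004.…_maninFree` (`ord₃ #Ш(3) ≤ ord₃(L(E,1)/Ω(W)) − v₃(c₃) ≤ 0`):
  `deepUpperAtThree_potGood_of_unitLevelOne_of_kato2004ManinFree` — the crux's EXACT conclusion
  (with its deep term, `d = 0`), not only the truncation of `KimAtThreeKolyvaginDeepUpperRung`.
These are CALIBRATION rungs: they certify in the kernel that the three crux statements, as typed in
the `∂`-vocabulary, agree with print on the regime print decides (a mis-normalised `∂^{(∞)}_{deep}`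
would already fail here), and they make the unit-`δ̃₁` pot-good rows of the leaf
`N11.KimAtThreeRankZeroPUB` a theorem-from-print via the route's own bridge
(`kimAtThreeRankZeroPUB_unitLevelOne_potGood_of_kato2004ManinFree`). By-products (general `p`):
`kuriharaDivIndex_one_lt_top_of_kuriharaVanishingOrder_eq_zero` (`ord(δ̃) = 0 ⇒ δ̃₁ ≠ 0`),
`kuriharaPartialDeepInfty_eq_zero_of_kuriharaDivIndex_one_eq_zero`.
Every printed input is a hypothesis BY NAME; nothing is asserted; the cruxes stay open.
[cite: Kim2022StructureSelmer, §1.4.3–1.4.4 and §1.5.1 (PDF p. 7)] [cite: MazurRubin2004, Def. 4.5.7, Def. 5.2.11]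
[cite: Kato2004Asterisque, Thm. 14.5 (3) (p. 236), Prop. 14.16 (2) (p. 244)] [cite: Kim2025RefinedTNC, Thm 1.1, Thm 1.2]
-/

set_option autoImplicit false
-- the Theorems namespace of a single-conjunct summit repeats the summit name by design (D-0017)
set_option linter.dupNamespace false

noncomputable section

open scoped MatrixGroups ModularForm Classical

open CongruenceSubgroup WeierstrassCurve Literature.NumberTheory.EllipticCurves
  Literature.NumberTheory.EllipticCurves.ModularForms

namespace Summit.BirchSwinnertonDyer.BirchSwinnertonDyer.Theorems.KimAtThreeKolyvaginUnitLevelOneRungs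

open Summit.BirchSwinnertonDyer.Rank1Residual.Additive
open Summit.BirchSwinnertonDyer.BirchSwinnertonDyer.Theses.KimAtThreeKolyvagin
open Summit.BirchSwinnertonDyer.BirchSwinnertonDyer.Theorems.KimAtThreeKolyvaginDeepUpperRung

/-! ### Level-`1` bookkeeping (general `p`) -/

section LevelOne

variable (W : WeierstrassCurve ℚ) [W.IsGloballyMinimal] (p : ℕ) {N : ℕ} (f : CuspForm (Gamma0 N) 2)

/-- **`ord(δ̃) = 0 ⇒ δ̃₁ ≠ 0` in `ℤ_p`** (`kuriharaDivIndex W p f 1 < ⊤`): the vanishing order is an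
infimum of `ν(n)` over the cyclic levels with `δ̃_n ≠ 0`; if it is `0` it is attained (`ℕ∞`), at a
level with no prime factor, i.e. `n = 1`. Converse of `kuriharaVanishingOrder_eq_zero_of`.
[cite: Kim2022StructureSelmer, §1.4.4 (PDF p. 7)] -/
theorem kuriharaDivIndex_one_lt_top_of_kuriharaVanishingOrder_eq_zero
    (hord : kuriharaVanishingOrder W p f = 0) : kuriharaDivIndex W p f 1 < ⊤ := by
  unfold kuriharaVanishingOrder at hord
  obtain ⟨n, hn⟩ := ENat.iInf_eq_zero.mp hord
  obtain ⟨hcyc, hn'⟩ := ENat.iInf_eq_zero.mp hn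
  obtain ⟨hlt, hcard⟩ := ENat.iInf_eq_zero.mp hn'
  have h0 : n.primeFactors = ∅ := Finset.card_eq_zero.mp (by exact_mod_cast hcard)
  rcases Nat.primeFactors_eq_empty.mp h0 with h | h
  · exact absurd h hcyc.1.ne_zero
  · rwa [h] at hlt

/-- **`ord(δ̃) = 0 ⇒ [0]⁺_f ≠ 0`** (a vanishing `[0]⁺_f` makes `δ̃₁` divisible by every `p^j`).
[cite: Kim2022StructureSelmer, §1.4.3–1.4.4 (PDF p. 7)] -/
theorem ratPlusSymbol_zero_ne_zero_of_kuriharaVanishingOrder_eq_zero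
    (hord : kuriharaVanishingOrder W p f = 0) : ratPlusSymbol f 0 ≠ 0 := by
  intro h0
  have htop := kuriharaPartial_zero_eq_top_of_ratPlusSymbol_eq_zero W p f h0
  rw [kuriharaPartial_zero] at htop
  exact (kuriharaDivIndex_one_lt_top_of_kuriharaVanishingOrder_eq_zero W p f hord).ne htop

/-- **A unit `δ̃₁` kills the deep infimum: `kuriharaDivIndex W p f 1 = 0 ⇒ ∂^{(∞)}_{deep}(δ̃) = 0`.**
The level `n = 1` is cyclic and lies in `𝒩_k` for every `k`, so `∂⁽⁰⁾(δ̃^{(k)}) ≤ min(k, 0) = 0` at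
every depth, `∂⁽⁰⁾_{deep} = 0`, and `∂^{(∞)}_{deep} ≤ ∂⁽⁰⁾_{deep}`.
[cite: MazurRubin2004, Def. 4.5.7, Def. 5.2.11] [cite: Kim2022StructureSelmer, §1.5.1 (PDF p. 7)] -/
theorem kuriharaPartialDeepInfty_eq_zero_of_kuriharaDivIndex_one_eq_zero
    (h1 : kuriharaDivIndex W p f 1 = 0) : kuriharaPartialDeepInfty W p f = 0 := by
  refine le_antisymm ?_ zero_le
  refine (kuriharaPartialDeepInfty_le W p f 0).trans ?_
  refine iSup_le fun k => ?_
  refine (kuriharaPartialDeepAt_le W p f (isCyclicKolyvaginLevel_one W p)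
    Kato.IsKolyvaginProduct.one (by rw [Nat.primeFactors_one, Finset.card_empty])).trans ?_
  rw [h1]
  exact min_le_right _ _

/-- A unit `δ̃₁` kills the shallow infimum too: `kuriharaDivIndex W p f 1 = 0 ⇒ ∂^{(∞)}(δ̃) = 0`.
[cite: Kim2022StructureSelmer, §1.5.1 (PDF p. 7)] -/
theorem kuriharaPartialInfty_eq_zero_of_kuriharaDivIndex_one_eq_zero
    (h1 : kuriharaDivIndex W p f 1 = 0) : kuriharaPartialInfty W p f = 0 := by
  refine le_antisymm ?_ zero_le
  refine (kuriharaPartialInfty_le W p f 0).trans ?_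
  rw [kuriharaPartial_zero, h1]

/-- **The unit slice in valuation form**: for `p`-integral non-zero `[0]⁺_f` with `ord_p [0]⁺_f = 0`,
`kuriharaDivIndex W p f 1 = 0` (`kuriharaDivIndex_one_eq`). [cite: Kim2022StructureSelmer, §1.5.1 (PDF p. 7)] -/
theorem kuriharaDivIndex_one_eq_zero_of_padicValRat_eq_zero [Fact p.Prime]
    (hint : ¬ p ∣ (ratPlusSymbol f 0).den) (hne : ratPlusSymbol f 0 ≠ 0)
    (hv : padicValRat p (ratPlusSymbol f 0) = 0) : kuriharaDivIndex W p f 1 = 0 := by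
  rw [kuriharaDivIndex_one_eq W p f hint hne, hv]
  rfl

end LevelOne

/-! ### The three cruxes on the unit-`δ̃₁` slice -/

/-- Under the tower (use `n = 1`), `[0]⁺_f` has denominator prime to `3`. [folklore] -/
private theorem not_dvd_den_of_tower (W : WeierstrassCurve ℚ) [W.IsElliptic] [W.IsGloballyMinimal]
    (htower : ∀ n : ℕ, W.HasSurjectiveModNGaloisRep (3 ^ n : ℕ))
    {N : ℕ} [NeZero N] (f : CuspForm (Gamma0 N) 2) (hf : IsNewformOf W f) :
    ¬ 3 ∣ (ratPlusSymbol f 0).den :=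
  not_dvd_den_of_norm_ratCast_le_one (norm_ratPlusSymbol_le_one_of_irreducible (by norm_num) hf
    (hasIrreducibleModPGaloisRep_of_hasSurjectiveModNGaloisRep W 3 (by simpa using htower 1)) 0)

/-- **`DeepLowerAtThree` on the unit-`δ̃₁` slice, unconditionally**: with the crux's binders and
`ord₃ [0]⁺_f = 0`, `∂^{(∞)}_{deep}(δ̃) = 0` and `∂⁽⁰⁾(δ̃) = 0 ≤ ord₃ #Ш(E/ℚ)(3) + 0`. A rung of item
`stmt-BirchSwinnertonDyer-19075` (one extra binder, same conclusion).
[cite: Kim2022StructureSelmer, §1.5.1 (PDF p. 7)] [cite: MazurRubin2004, Def. 5.2.11] -/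
theorem deepLowerAtThree_of_unitLevelOne :
    ∀ (W : WeierstrassCurve ℚ) [W.IsElliptic] [W.IsGloballyMinimal],
      (∀ n : ℕ, W.HasSurjectiveModNGaloisRep (3 ^ n : ℕ)) →
      Finite W.sha →
      ∀ {N : ℕ} [NeZero N] (f : CuspForm (Gamma0 N) 2), IsNewformOf W f →
      (∀ r : ℚ, ratPlusSymbol f r ≠ 0 → 0 ≤ padicValRat 3 (ratPlusSymbol f r)) →
      kuriharaVanishingOrder W 3 f = 0 →
      padicValRat 3 (ratPlusSymbol f 0) = 0 →
        ∃ d : ℕ, kuriharaPartialDeepInfty W 3 f = d ∧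
          kuriharaPartial W 3 f 0 ≤
            ((padicValNat 3 (Nat.card (AddCommGroup.primaryComponent W.sha 3)) + d : ℕ) : ℕ∞) := by
  intro W _ _ htower _ N _ f hf _ hord hv
  have h1 := kuriharaDivIndex_one_eq_zero_of_padicValRat_eq_zero W 3 f (not_dvd_den_of_tower W htower f hf)
    (ratPlusSymbol_zero_ne_zero_of_kuriharaVanishingOrder_eq_zero W 3 f hord) hv
  refine ⟨0, ?_, ?_⟩
  · rw [kuriharaPartialDeepInfty_eq_zero_of_kuriharaDivIndex_one_eq_zero W 3 f h1, Nat.cast_zero]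
  · rw [kuriharaPartial_zero, h1]
    exact zero_le

/-- **`ShallowEqDeepAtTorsionFree` on the unit-`δ̃₁` slice, unconditionally** (and without the
`E(ℚ₃)[3] = 0` binder, which is carried but unused): `∂^{(∞)}_{deep}(δ̃) = 0 ≤ ∂^{(∞)}(δ̃)`. A rung of
item `stmt-BirchSwinnertonDyer-19077`. [cite: Kim2022StructureSelmer, §1.5.1 (PDF p. 7)] [cite: MazurRubin2004, Def. 5.2.11] -/
theorem shallowEqDeepAtTorsionFree_of_unitLevelOne :
    ∀ (W : WeierstrassCurve ℚ) [W.IsElliptic] [W.IsGloballyMinimal],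
      (∀ n : ℕ, W.HasSurjectiveModNGaloisRep (3 ^ n : ℕ)) →
      Nat.card {Q : (W.baseChange ℚ_[3]).toAffine.Point // (3 : ℕ) • Q = 0} = 1 →
      Finite W.sha →
      ∀ {N : ℕ} [NeZero N] (f : CuspForm (Gamma0 N) 2), IsNewformOf W f →
      (∀ r : ℚ, ratPlusSymbol f r ≠ 0 → 0 ≤ padicValRat 3 (ratPlusSymbol f r)) →
      kuriharaVanishingOrder W 3 f = 0 →
      padicValRat 3 (ratPlusSymbol f 0) = 0 →
        kuriharaPartialDeepInfty W 3 f ≤ kuriharaPartialInfty W 3 f := by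
  intro W _ _ htower _ _ N _ f hf _ hord hv
  have h1 := kuriharaDivIndex_one_eq_zero_of_padicValRat_eq_zero W 3 f (not_dvd_den_of_tower W htower f hf)
    (ratPlusSymbol_zero_ne_zero_of_kuriharaVanishingOrder_eq_zero W 3 f hord) hv
  rw [kuriharaPartialDeepInfty_eq_zero_of_kuriharaDivIndex_one_eq_zero W 3 f h1]
  exact zero_le

/-- **`DeepUpperAtThree` on the unit-`δ̃₁` slice of Kato's printed stratum, EXACT conclusion**: for
`W/ℚ` globally minimal with the tower onto, `Ш(E/ℚ)` finite, `f` the newform (crux binders), `3`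
additive potentially good, the period transfer `Ω(W) = u · Ω⁺_f` (`|u|₃ = 1`) and `ord₃ [0]⁺_f = 0`:
`∂^{(∞)}_{deep}(δ̃) = 0` and `ord₃ #Ш(E/ℚ)(3) + 0 ≤ ∂⁽⁰⁾(δ̃) = 0` — i.e. `Ш(E/ℚ)[3^∞] = 0`, which is the
named fact `hKato` (Kato Thm. 14.5 (3) + Prop. 14.16 (2), Manin-free `c₃`-sharpened reading) via the
bridge `natCast_le_kuriharaPartial_zero_of_le_padicValRat`. A rung of item `stmt-BirchSwinnertonDyer-19076`
with the crux's own deep term. [cite: Kato2004Asterisque, Thm. 14.5 (3) (p. 236), Prop. 14.16 (2) (p. 244)]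
[cite: Kim2022StructureSelmer, §1.5.1 (PDF p. 7)] -/
theorem deepUpperAtThree_potGood_of_unitLevelOne_of_kato2004ManinFree
    (hKato : Kato2004.rankZero_padicValNat_sha_le_sub_localTamagawa_of_additive_potGood_of_imageContainsSL2_maninFree) :
    ∀ (W : WeierstrassCurve ℚ) [W.IsElliptic] [W.IsGloballyMinimal],
      (∀ n : ℕ, W.HasSurjectiveModNGaloisRep (3 ^ n : ℕ)) →
      Finite W.sha →
      ∀ {N : ℕ} [NeZero N] (f : CuspForm (Gamma0 N) 2), IsNewformOf W f →
      (∀ r : ℚ, ratPlusSymbol f r ≠ 0 → 0 ≤ padicValRat 3 (ratPlusSymbol f r)) →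
      kuriharaVanishingOrder W 3 f = 0 →
      ¬ W.HasGoodReductionAtPrime 3 → ¬ W.HasMultiplicativeReductionAtPrime 3 →
      0 ≤ padicValRat 3 W.j →
      (∃ u : ℚ, ‖(u : ℚ_[3])‖ = 1 ∧ W.realPeriodRat = u * plusPeriod f) →
      padicValRat 3 (ratPlusSymbol f 0) = 0 →
        ∃ d : ℕ, kuriharaPartialDeepInfty W 3 f = d ∧
          ((padicValNat 3 (Nat.card (AddCommGroup.primaryComponent W.sha 3)) + d : ℕ) : ℕ∞) ≤
            kuriharaPartial W 3 f 0 := by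
  intro W _ _ htower hfin N _ f hf hint hord hgood hmult hpot hper hv
  have h1 := kuriharaDivIndex_one_eq_zero_of_padicValRat_eq_zero W 3 f (not_dvd_den_of_tower W htower f hf)
    (ratPlusSymbol_zero_ne_zero_of_kuriharaVanishingOrder_eq_zero W 3 f hord) hv
  refine ⟨0, ?_, ?_⟩
  · rw [kuriharaPartialDeepInfty_eq_zero_of_kuriharaDivIndex_one_eq_zero W 3 f h1, Nat.cast_zero]
  · rw [add_zero]
    exact deepUpperAtThree_truncation_potGood_of_kato2004ManinFree hKato W htower hfin f hf hint hord hgood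
      hmult hpot hper

/-- **The leaf on the unit-`δ̃₁` pot-good slice, from print, through the route's own bridge**: the three
slice rungs feed `KimAtThreeKolyvaginInputs.kimAtThreeRankZeroPUB_of_inputs`-style bookkeeping
(antisymmetry in `ℕ∞`) and give `N11.KimAtThreeRankZeroPUB`'s conclusion (`∂^{(∞)}(δ̃) = 0`,
`∂⁽⁰⁾(δ̃) = ord₃ #Ш(3) + 0`) on those rows — Kato's theorem re-read in Kim's currency; calibration only.
[cite: Kato2004Asterisque, Thm. 14.5 (3) (p. 236)] [cite: Kim2025RefinedTNC, Thm 1.2] -/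
theorem kimAtThreeRankZeroPUB_unitLevelOne_potGood_of_kato2004ManinFree
    (hKato : Kato2004.rankZero_padicValNat_sha_le_sub_localTamagawa_of_additive_potGood_of_imageContainsSL2_maninFree) :
    ∀ (W : WeierstrassCurve ℚ) [W.IsElliptic] [W.IsGloballyMinimal],
      (∀ n : ℕ, W.HasSurjectiveModNGaloisRep (3 ^ n : ℕ)) →
      Finite W.sha →
      ∀ {N : ℕ} [NeZero N] (f : CuspForm (Gamma0 N) 2), IsNewformOf W f →
      (∀ r : ℚ, ratPlusSymbol f r ≠ 0 → 0 ≤ padicValRat 3 (ratPlusSymbol f r)) →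
      kuriharaVanishingOrder W 3 f = 0 →
      ¬ W.HasGoodReductionAtPrime 3 → ¬ W.HasMultiplicativeReductionAtPrime 3 →
      0 ≤ padicValRat 3 W.j →
      (∃ u : ℚ, ‖(u : ℚ_[3])‖ = 1 ∧ W.realPeriodRat = u * plusPeriod f) →
      padicValRat 3 (ratPlusSymbol f 0) = 0 →
        ∃ d : ℕ, kuriharaPartialInfty W 3 f = d ∧
          kuriharaPartial W 3 f 0 =
            ((padicValNat 3 (Nat.card (AddCommGroup.primaryComponent W.sha 3)) + d : ℕ) : ℕ∞) := by
  intro W _ _ htower hfin N _ f hf hint hord hgood hmult hpot hper hv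
  have h1 := kuriharaDivIndex_one_eq_zero_of_padicValRat_eq_zero W 3 f (not_dvd_den_of_tower W htower f hf)
    (ratPlusSymbol_zero_ne_zero_of_kuriharaVanishingOrder_eq_zero W 3 f hord) hv
  obtain ⟨d, hd, hle⟩ := deepUpperAtThree_potGood_of_unitLevelOne_of_kato2004ManinFree hKato W htower
    hfin f hf hint hord hgood hmult hpot hper hv
  have hd0 : d = 0 := by
    rw [kuriharaPartialDeepInfty_eq_zero_of_kuriharaDivIndex_one_eq_zero W 3 f h1] at hd
    exact_mod_cast hd.symm
  subst hd0
  refine ⟨0, ?_, le_antisymm ?_ hle⟩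
  · rw [kuriharaPartialInfty_eq_zero_of_kuriharaDivIndex_one_eq_zero W 3 f h1, Nat.cast_zero]
  · rw [kuriharaPartial_zero, h1]
    exact zero_le

end Summit.BirchSwinnertonDyer.BirchSwinnertonDyer.Theorems.KimAtThreeKolyvaginUnitLevelOneRungs

end
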